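import Summits.QuantumFields.YangMills.Theorems.ForcedResponseSkewnessResponseLocalisationContactOfFemtoToolkit
import Summits.QuantumFields.YangMills.Theorems.BalabanLadderNTReferenceTransferCumulant
import Summits.QuantumFields.YangMills.Theorems.LangevinControlUVOSLegsFromFemtoAndGapStubLowerCube
import HarnessLib

/-!
# Route `ForcedResponseSkewness`, crux `RunningCouplingCeiling` (stmt-QuantumFields-24275), line «pointwise-log-ceiling-r»:
# toolkit for the femto reduction of `stub_logCeiling` (one torus DLR step for a pair; real bookkeeping)

Helper file (`--supports stmt-QuantumFields-24275`, route-independent: no `Theses` import) of the width prover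
`ym-line-frs-p3` (g5), companion of `…RunningCouplingCeilingLogCeilingOfFemto.lean`:

* §1 one torus DLR step for a pair of action densities: `torusCov β L x y = torusCov β L x (x + w)` for the cyclic
  representative `w` of `y − x` (periodicity of the lifted density), and
  `|torusCov β L x (x+w)| ≤ sup_η |kerCov_P^η(dens x, dens (x+w))| + 4 h₁ h₂` for a cube `P` of radius `R` around `x` holding
  both sites, `h₁, h₂` = exterior-uniform deviations of the `P`-kernel one-point means from constants (law of total covariance
  through `P`: the NT fleet's `Reference.abs_torusCov_sub_torusE_kerCov_le`);
* §2 real-arithmetic bookkeeping of the femto cube: `s⁸ log²(1/s) ≤ 1`, the boundary-term estimate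
  `d⁸ · (C₂/(d⁸log²) + 4(C₁/D⁴)²) · log² ≤ C₂ + 4C₁²(16/(3ℓ))⁸` when `d ≤ (16s/(3ℓ))·D`, and the geometry of the radius
  `R = ⌊ℓ/(4a)⌋₊` cube (femto, depth margin `≥ 3ℓ/(16a)`, fits in tori `a·L ≥ ℓ + 1`).

No summit is proved by any of this: the line is a CONDITIONAL rung line (leaf R2a `BalabanLadder.NT`, residual
`FloorWithScalingLimits` 24873); `stub_logCeiling` is only REDUCED to a femto statement; the Yang–Mills mass gap is NOT proved.
Refs: Georgii, Gibbs Measures (2011) Thm. 4.17; tree `LatticeGaugeDLRFarFactorProofs`, `BalabanLadderNTReferenceTransfer`.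
-/

set_option autoImplicit false

noncomputable section

namespace Summit.QuantumFields.YangMills.Cruxes.RunningCouplingCeiling.Pointwise

open scoped SchwartzMap
open MeasureTheory Filter Topology
open Literature.MathematicalPhysics.QuantumFieldTheory Literature.MathematicalPhysics.QuantumLattice
open Literature.Probability.LatticeModels
open Summit.QuantumFields.YangMills.Cruxes.OSLegsFromFemtoAndGap.DlrCollarTransfer
open Summit.QuantumFields.YangMills.Cruxes.OSLegsFromFemtoAndGap.DlrCollarTransfer.StubLower
  (exists_abs_dens_le le_depth_cube)
open Summit.QuantumFields.YangMills.Cruxes.NT.Reference (abs_torusCov_sub_torusE_kerCov_le dens_supp_window_of_depth_pos)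
open Summit.QuantumFields.YangMills.Cruxes.ResponseLocalisation.Femto (abs_apply_le_norm dens_torusLift_congr)

/-! ## §1 One torus DLR step for a pair of action densities -/

/-- The norm of the cyclic representative of `y − x` is the torus distance of `x` and `y` (cf. the lead's
`…ResponseLocalisation.Femto.norm_wrep`; restated to keep this file independent of modules still building). [folklore] -/
theorem norm_wrep' (L : ℕ) (x y : Fin 4 → ℤ) :
    ‖siteToE (fun k : Fin 4 => ((((y k - x k : ℤ) : ZMod (2 * L + 1))).valMinAbs : ℤ))‖ = torusDist L x y := by
  rw [EuclideanSpace.norm_eq]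
  unfold torusDist
  congr 1
  refine Finset.sum_congr rfl fun k _ => ?_
  rw [siteToE_apply, Real.norm_eq_abs, sq_abs]
  -- symmetry of the cyclic separation: `|valMinAbs (y−x)| = |valMinAbs (x−y)|`
  have h : ((y k - x k : ℤ) : ZMod (2 * L + 1)) = -((x k - y k : ℤ) : ZMod (2 * L + 1)) := by push_cast; ring
  have habs : |((((x k - y k : ℤ) : ZMod (2 * L + 1))).valMinAbs : ℤ)| =
      |((((y k - x k : ℤ) : ZMod (2 * L + 1))).valMinAbs : ℤ)| := by
    rw [h, Int.abs_eq_natAbs, Int.abs_eq_natAbs, ZMod.natAbs_valMinAbs_neg]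
  have h2 : ((((y k - x k : ℤ) : ZMod (2 * L + 1))).valMinAbs : ℤ) ^ 2 =
      ((((x k - y k : ℤ) : ZMod (2 * L + 1))).valMinAbs : ℤ) ^ 2 := by
    rw [← sq_abs, ← habs, sq_abs]
  exact_mod_cast congrArg (fun t : ℤ => (t : ℝ)) h2

section Pair

variable {G : Type} [Group G] [TopologicalSpace G] [IsTopologicalGroup G] [CompactSpace G]
  [MeasurableSpace G] [BorelSpace G] (r : LatticeRep G)

/-- **Periodicity**: the torus covariance of the action densities at `x, y` equals that at `x, x + w` for the cyclic
representative `w` of `y − x` modulo `2L+1`. [folklore] -/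
theorem torusCov_eq_torusCov_add_wrep (β : ℝ) (L : ℕ) (x y : Fin 4 → ℤ) :
    torusCov G r β L x y =
      torusCov G r β L x (x + fun k : Fin 4 => ((((y k - x k : ℤ) : ZMod (2 * L + 1))).valMinAbs : ℤ)) := by
  set w : Fin 4 → ℤ := fun k : Fin 4 => ((((y k - x k : ℤ) : ZMod (2 * L + 1))).valMinAbs : ℤ) with hw
  have hcong : ∀ k, ((y k : ℤ) : ZMod (2 * L + 1)) = (((x + w) k : ℤ) : ZMod (2 * L + 1)) := fun k => by
    simp only [hw, Pi.add_apply, Int.cast_add, ZMod.coe_valMinAbs, Int.cast_sub]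
    ring
  have hV : ∀ V : GaugeConfig 4 (2 * L + 1) G,
      dens G r y (torusLift (2 * L + 1) V) = dens G r (x + w) (torusLift (2 * L + 1) V) := fun V =>
    dens_torusLift_congr r (2 * L + 1) hcong V
  unfold torusCov torusE
  simp_rw [hV]

/-- **One torus DLR step for a pair.**  A cube `P` of radius `R` around `x` (corner `x − R`, side `2R+1`) inside the torus
of side `2L+1 ≥ 2R+4`, a second site `x + w` of depth `≥ 1` in `P`; if the `P`-kernel one-point means of `dens x`,
`dens (x+w)` are within `h₁, h₂` of constants for EVERY exterior and the `P`-kernel covariance is bounded by `m` for every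
exterior, then `|torusCov β L x (x+w)| ≤ m + 4 h₁ h₂` (law of total covariance through `P`:
`Reference.abs_torusCov_sub_torusE_kerCov_le`). [folklore] -/
theorem abs_torusCov_le_of_cube (β : ℝ) (x w : Fin 4 → ℤ) (R L : ℕ) (hRL : 2 * R + 1 + 3 ≤ 2 * L + 1)
    (hx : 1 ≤ depth (fun j => x j - R) (2 * R + 1) x) (hxw : 1 ≤ depth (fun j => x j - R) (2 * R + 1) (x + w))
    {p₁ p₂ h₁ h₂ m : ℝ}
    (hB₁ : ∀ η, |kerE G r β (fun j => x j - R) (2 * R + 1) η (dens G r x) - p₁| ≤ h₁)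
    (hB₂ : ∀ η, |kerE G r β (fun j => x j - R) (2 * R + 1) η (dens G r (x + w)) - p₂| ≤ h₂)
    (hC : ∀ η, |kerCov G r β (fun j => x j - R) (2 * R + 1) η (dens G r x) (dens G r (x + w))| ≤ m) :
    |torusCov G r β L x (x + w)| ≤ m + 4 * h₁ * h₂ := by
  haveI := r.secondCountableTopology
  haveI := isProbabilityMeasure_wilsonMeasure (d := 4) (L := 2 * L + 1) r.ρ r.continuous β
  obtain ⟨M, -, hM⟩ := exists_abs_dens_le G r
  have hoF : ∀ ζ ζ', |kerE G r β (fun j => x j - R) (2 * R + 1) ζ (dens G r x) -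
      kerE G r β (fun j => x j - R) (2 * R + 1) ζ' (dens G r x)| ≤ 2 * h₁ := fun ζ ζ' => by
    have t := abs_sub_le (kerE G r β (fun j => x j - R) (2 * R + 1) ζ (dens G r x)) p₁
      (kerE G r β (fun j => x j - R) (2 * R + 1) ζ' (dens G r x))
    have t' := hB₁ ζ'
    rw [abs_sub_comm] at t'
    linarith [hB₁ ζ]
  have hoG : ∀ ζ ζ', |kerE G r β (fun j => x j - R) (2 * R + 1) ζ (dens G r (x + w)) -
      kerE G r β (fun j => x j - R) (2 * R + 1) ζ' (dens G r (x + w))| ≤ 2 * h₂ := fun ζ ζ' => by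
    have t := abs_sub_le (kerE G r β (fun j => x j - R) (2 * R + 1) ζ (dens G r (x + w))) p₂
      (kerE G r β (fun j => x j - R) (2 * R + 1) ζ' (dens G r (x + w)))
    have t' := hB₂ ζ'
    rw [abs_sub_comm] at t'
    linarith [hB₂ ζ]
  have key := abs_torusCov_sub_torusE_kerCov_le G r β (fun j => x j - R) (2 * R + 1) L hRL
    (continuous_dens r x) (continuous_dens r (x + w)) (hM x) (hM (x + w))
    (StubLower.isCylinder_dens G r x) (StubLower.isCylinder_dens G r (x + w))
    (dens_supp_window_of_depth_pos G r hx) (dens_supp_window_of_depth_pos G r hxw) hoF hoG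
  have hE : |torusE G r β L (fun ζ => kerCov G r β (fun j => x j - R) (2 * R + 1) ζ (dens G r x) (dens G r (x + w)))|
      ≤ m := by
    unfold torusE
    exact abs_integral_le_of_abs_le fun U => hC _
  have tri := abs_sub_le (torusE G r β L (fun U => dens G r x U * dens G r (x + w) U) -
      torusE G r β L (dens G r x) * torusE G r β L (dens G r (x + w)))
    (torusE G r β L (fun ζ => kerCov G r β (fun j => x j - R) (2 * R + 1) ζ (dens G r x) (dens G r (x + w)))) 0
  simp only [sub_zero] at tri
  unfold torusCov
  nlinarith [key, hE, tri]

end Pair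


/-! ## §2 Real bookkeeping of the femto cube -/

/-- `s⁸ · log²(1/s) ≤ 1` on `(0, 1]` (`log t ≤ t − 1`). [folklore] -/
theorem pow_eight_mul_log_sq_le_one {s : ℝ} (hs : 0 < s) (hs1 : s ≤ 1) :
    s ^ 8 * Real.log (1 / s) ^ 2 ≤ 1 := by
  have hlog0 : 0 ≤ Real.log (1 / s) := Real.log_nonneg (by rw [le_div_iff₀ hs]; linarith)
  have hlog1 : Real.log (1 / s) ≤ 1 / s := by
    have := Real.log_le_sub_one_of_pos (show 0 < 1 / s by positivity)
    linarith
  have h1 : s * Real.log (1 / s) ≤ 1 := by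
    calc s * Real.log (1 / s) ≤ s * (1 / s) := mul_le_mul_of_nonneg_left hlog1 hs.le
      _ = 1 := by field_simp
  have h2 : 0 ≤ s * Real.log (1 / s) := mul_nonneg hs.le hlog0
  have hs6 : s ^ 6 ≤ 1 := pow_le_one₀ hs.le hs1
  calc s ^ 8 * Real.log (1 / s) ^ 2 = s ^ 6 * (s * Real.log (1 / s)) ^ 2 := by ring
    _ ≤ 1 * 1 ^ 2 := by
        gcongr
    _ = 1 := by norm_num

/-- Real-arithmetic bookkeeping of the femto case: with `d ≤ (16s/(3ℓ))·D` and the one-step bound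
`T ≤ C₂/(d⁸ log²(1/s)) + 4 (C₁/D⁴)²`, one gets `d⁸ · T · log²(1/s) ≤ C₂ + 4 C₁² (16/(3ℓ))⁸` (uses `s⁸ log²(1/s) ≤ 1`). [folklore] -/
theorem femto_bookkeeping {d D s ℓ C₁ C₂ T : ℝ} (hd0 : 0 < d) (hDpos : 0 < D) (hℓ : 0 < ℓ) (hs0 : 0 < s)
    (hs1 : s ≤ 1) (hlog : 0 < Real.log (1 / s)) (hdD : d ≤ 16 * s / (3 * ℓ) * D)
    (hT : T ≤ C₂ / (d ^ 8 * Real.log (1 / s) ^ 2) + 4 * (C₁ / D ^ 4) * (C₁ / D ^ 4)) :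
    d ^ 8 * T * Real.log (1 / s) ^ 2 ≤ C₂ + 4 * C₁ ^ 2 * (16 / (3 * ℓ)) ^ 8 := by
  have hl2 : 0 < Real.log (1 / s) ^ 2 := pow_pos hlog 2
  have hD8 : 0 < D ^ 8 := pow_pos hDpos 8
  have hd8pos : 0 < d ^ 8 := pow_pos hd0 8
  have hslog : s ^ 8 * Real.log (1 / s) ^ 2 ≤ 1 := pow_eight_mul_log_sq_le_one hs0 hs1
  have hd8 : d ^ 8 ≤ (16 / (3 * ℓ)) ^ 8 * s ^ 8 * D ^ 8 := by
    calc d ^ 8 ≤ (16 * s / (3 * ℓ) * D) ^ 8 := pow_le_pow_left₀ hd0.le hdD 8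
      _ = (16 / (3 * ℓ)) ^ 8 * s ^ 8 * D ^ 8 := by rw [mul_pow, show 16 * s / (3 * ℓ) = 16 / (3 * ℓ) * s by ring, mul_pow]
  -- the boundary term
  have hq : d ^ 8 * (4 * (C₁ / D ^ 4) * (C₁ / D ^ 4)) * Real.log (1 / s) ^ 2 ≤ 4 * C₁ ^ 2 * (16 / (3 * ℓ)) ^ 8 := by
    have e1 : d ^ 8 * (4 * (C₁ / D ^ 4) * (C₁ / D ^ 4)) * Real.log (1 / s) ^ 2 =
        4 * C₁ ^ 2 * (d ^ 8 * Real.log (1 / s) ^ 2) / D ^ 8 := by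
      rw [eq_div_iff hD8.ne']
      have : D ^ 4 ≠ 0 := pow_ne_zero 4 hDpos.ne'
      field_simp
    rw [e1, div_le_iff₀ hD8]
    calc 4 * C₁ ^ 2 * (d ^ 8 * Real.log (1 / s) ^ 2)
        ≤ 4 * C₁ ^ 2 * ((16 / (3 * ℓ)) ^ 8 * s ^ 8 * D ^ 8 * Real.log (1 / s) ^ 2) := by
          have : d ^ 8 * Real.log (1 / s) ^ 2 ≤ (16 / (3 * ℓ)) ^ 8 * s ^ 8 * D ^ 8 * Real.log (1 / s) ^ 2 :=
            mul_le_mul_of_nonneg_right hd8 hl2.le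
          exact mul_le_mul_of_nonneg_left this (by positivity)
      _ = 4 * C₁ ^ 2 * (16 / (3 * ℓ)) ^ 8 * D ^ 8 * (s ^ 8 * Real.log (1 / s) ^ 2) := by ring
      _ ≤ 4 * C₁ ^ 2 * (16 / (3 * ℓ)) ^ 8 * D ^ 8 * 1 := mul_le_mul_of_nonneg_left hslog (by positivity)
      _ = 4 * C₁ ^ 2 * (16 / (3 * ℓ)) ^ 8 * D ^ 8 := mul_one _
  -- the conditional-covariance term
  have hm : d ^ 8 * (C₂ / (d ^ 8 * Real.log (1 / s) ^ 2)) * Real.log (1 / s) ^ 2 = C₂ := by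
    field_simp
  calc d ^ 8 * T * Real.log (1 / s) ^ 2
      ≤ d ^ 8 * (C₂ / (d ^ 8 * Real.log (1 / s) ^ 2) + 4 * (C₁ / D ^ 4) * (C₁ / D ^ 4)) * Real.log (1 / s) ^ 2 :=
        mul_le_mul_of_nonneg_right (mul_le_mul_of_nonneg_left hT hd8pos.le) hl2.le
    _ = d ^ 8 * (C₂ / (d ^ 8 * Real.log (1 / s) ^ 2)) * Real.log (1 / s) ^ 2 +
          d ^ 8 * (4 * (C₁ / D ^ 4) * (C₁ / D ^ 4)) * Real.log (1 / s) ^ 2 := by ring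
    _ ≤ C₂ + 4 * C₁ ^ 2 * (16 / (3 * ℓ)) ^ 8 := by rw [hm]; exact add_le_add le_rfl hq

/-- Geometry of the femto cube (real arithmetic): spacing `α ≤ ℓ/16`, pair scale `s = α d ≤ ℓ/16`, cube radius
`R = ⌊ℓ/(4α)⌋₊`, depth margin `D = R + 1 − d`: the cube is femto (`(2R+1)α ≤ ℓ`), `D ≥ 3ℓ/(16α) ≥ 3`, `(ℓ/16)/α ≤ D`, and
`d ≤ (16 s/(3ℓ))·D`. [folklore] -/
theorem femto_cube_room {α ℓ s d : ℝ} {R : ℕ} (hα : 0 < α) (hαℓ : α ≤ ℓ / 16) (hℓ : 0 < ℓ) (hs0 : 0 < s)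
    (hsℓ : s ≤ ℓ / 16) (hsd : s = α * d) (hR : R = ⌊ℓ / (4 * α)⌋₊) :
    ((2 * R + 1 : ℕ) : ℝ) * α ≤ ℓ ∧ 3 * ℓ / (16 * α) ≤ (R : ℝ) + 1 - d ∧ (3 : ℝ) ≤ (R : ℝ) + 1 - d ∧
      (ℓ / 16) / α ≤ 3 * ℓ / (16 * α) ∧ d ≤ 16 * s / (3 * ℓ) * ((R : ℝ) + 1 - d) := by
  have h4α : 0 < 4 * α := by positivity
  have h16 : 0 < 16 * α := by positivity
  have hRle : (R : ℝ) ≤ ℓ / (4 * α) := by rw [hR]; exact Nat.floor_le (by positivity)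
  have hRge : ℓ / (4 * α) - 1 ≤ (R : ℝ) := by
    have := Nat.lt_floor_add_one (ℓ / (4 * α)); rw [hR]; linarith
  have hdsa : d = s / α := by rw [hsd]; field_simp
  have hfem : ((2 * R + 1 : ℕ) : ℝ) * α ≤ ℓ := by
    have h1 : (R : ℝ) * α ≤ ℓ / 4 := by
      calc (R : ℝ) * α ≤ ℓ / (4 * α) * α := mul_le_mul_of_nonneg_right hRle hα.le
        _ = ℓ / 4 := by field_simp
    push_cast
    nlinarith [h1, hαℓ, hℓ]
  have hD₀ : 3 * ℓ / (16 * α) ≤ (R : ℝ) + 1 - d := by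
    have h16' : 3 * ℓ / (16 * α) = ℓ / (4 * α) - (ℓ / 16) / α := by field_simp; ring
    have hsa : s / α ≤ (ℓ / 16) / α := div_le_div_of_nonneg_right hsℓ hα.le
    rw [h16', hdsa]
    linarith [hRge, hsa]
  have hD3 : (3 : ℝ) ≤ 3 * ℓ / (16 * α) := by
    rw [le_div_iff₀ h16]; linarith [hαℓ]
  have hq : (ℓ / 16) / α ≤ 3 * ℓ / (16 * α) := by
    rw [div_div, show ℓ / (16 * α) = ℓ / (16 * α) from rfl]
    exact div_le_div_of_nonneg_right (by linarith) h16.le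
  refine ⟨hfem, hD₀, hD3.trans hD₀, hq, ?_⟩
  have e1 : 16 * s / (3 * ℓ) * (3 * ℓ / (16 * α)) = s / α := by field_simp
  calc d = s / α := hdsa
    _ = 16 * s / (3 * ℓ) * (3 * ℓ / (16 * α)) := e1.symm
    _ ≤ 16 * s / (3 * ℓ) * ((R : ℝ) + 1 - d) := mul_le_mul_of_nonneg_left hD₀ (by positivity)

/-- The femto cube of radius `R ≤ ℓ/(4α)` fits in every torus of half-side `L` with `ℓ + 1 ≤ α L` (`α ≤ 1/2`). [folklore] -/
theorem femto_cube_fits {α ℓ : ℝ} {R L : ℕ} (hα : 0 < α) (hα2 : α ≤ 1 / 2) (hℓ : 0 < ℓ)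
    (hRle : (R : ℝ) ≤ ℓ / (4 * α)) (hL : ℓ + 1 ≤ α * L) : 2 * R + 1 + 3 ≤ 2 * L + 1 := by
  have hL' : (ℓ + 1) / α ≤ (L : ℝ) := by rw [div_le_iff₀ hα]; linarith
  have h2 : (2 : ℝ) ≤ 1 / α := by rw [le_div_iff₀ hα]; linarith
  have h3 : ℓ / (4 * α) ≤ ℓ / α := div_le_div_of_nonneg_left hℓ.le hα (by linarith)
  have h4 : (ℓ + 1) / α = ℓ / α + 1 / α := add_div ℓ 1 α
  have hR2 : (R : ℝ) + 2 ≤ (L : ℝ) := by linarith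
  have hR2' : R + 2 ≤ L := by exact_mod_cast hR2
  omega


end Summit.QuantumFields.YangMills.Cruxes.RunningCouplingCeiling.Pointwise

end
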